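import Literature.AlgebraicGeometry.FundamentalGroup.RiemannExistenceEtaleLocalHomeomorph
import Literature.AlgebraicGeometry.FundamentalGroup.RiemannExistenceFullyFaithfulContinuous
import Mathlib.Topology.SeparatedMap
import HarnessLib

/-!
# Continuous lifts through an étale morphism are unique on connected sets (complex points)

Topic `AlgebraicGeometry/FundamentalGroup`; namespace `Literature.AlgebraicGeometry.FundamentalGroup`; THEOREMS ONLY
(no definition, no named fact, no instance).  For a morphism `f : X ⟶ Y` of `ℂ`-schemes with `f` ÉTALE and `X`
separated over `ℂ`, the induced map on complex points `f(ℂ) : X(ℂ) → Y(ℂ)` is a local homeomorphism (★ SGA 1 XII 3.1,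
`isLocalHomeomorph_map_of_etale`), hence locally injective, and separated (`X(ℂ)` is Hausdorff, ★
`ComplexPoints.t2Space_of_isSeparated`).  Consequently (Mathlib `IsSeparatedMap.eq_of_comp_eq` and friends — the
unique-lifting half of covering-space theory, which needs only «separated + locally injective», NOT properness or
finiteness of `f`):

* `isSeparatedMap_map` — `f(ℂ)` is a separated map;
* `eq_of_comp_map_eq_of_etale` / `eqOn_of_comp_map_eqOn_of_etale` — two continuous maps `g₁ g₂ : A → X(ℂ)` from a
  (pre)connected space (set) with `f(ℂ) ∘ g₁ = f(ℂ) ∘ g₂` that agree at ONE point agree everywhere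
  ([Hatcher2002] Prop. 1.34 for étale maps; [SGA1] Exp. I Cor. 5.4-type rigidity of sections of étale maps on points);
* `const_of_comp_map_const_of_etale` / `constOn_of_comp_map_const_of_etale` — a continuous map into `X(ℂ)` whose
  composite with `f(ℂ)` is constant on a (pre)connected space (set) is constant: CONTINUOUS FAMILIES OF POINTS IN THE
  FIBRES OF AN ÉTALE MORPHISM ARE LOCALLY CONSTANT (e.g. torsion sections of a family of abelian varieties read in a
  continuous frame — the cell's (U)-head node U-e P4 (b2)).
* §3 (ed. 2) the same four statements for `f` merely UNRAMIFIED (formally unramified + locally of finite type) with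
  `Y` separated over `ℂ` — local injectivity of `f(ℂ)` is ★ `isLocallyInjective_map_of_formallyUnramified`
  ([SGA1] XII Prop. 3.1 (ii)); this is the form the abelian-scheme consumer uses (`[N]` on an abelian scheme over a base
  is unramified, ★ `AbelianSchemeOver.formallyUnramified_pow_id_left`).

## References
* [SGA1] A. Grothendieck, *Revêtements étales et groupe fondamental* (LNM 224), Exp. XII Prop. 3.1 (iii) (`f` étale ⇒
  `f^an` local isomorphism), Exp. I Cor. 5.3–5.4.
* [Hatcher2002] A. Hatcher, *Algebraic Topology* (2002), §1.3 Prop. 1.34 (p. 62) (unique lifting).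
* [Forster1981] O. Forster, *Lectures on Riemann Surfaces*, §4.8 (uniqueness of liftings for local homeomorphisms
  from Hausdorff spaces).
-/

set_option autoImplicit false

open CategoryTheory AlgebraicGeometry Set
open _root_.Topology

noncomputable section

namespace Literature.AlgebraicGeometry.FundamentalGroup

open Literature.AlgebraicGeometry.Motives Literature.AlgebraicGeometry.Motives.AlgPoints

variable {X Y : Motives.SchemeOver ℂ} (f : X ⟶ Y)

/-- **`f(ℂ)` is a separated map when `X` is separated over `ℂ`** (`X(ℂ)` is Hausdorff, ★
`ComplexPoints.t2Space_of_isSeparated`; every continuous map out of a Hausdorff space is separated).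
[cite: Forster1981, §4.8 (uniqueness of liftings; Hausdorff hypothesis)] -/
theorem isSeparatedMap_map [IsSeparated X.hom] :
    IsSeparatedMap (map f : Motives.ComplexPoints X → Motives.ComplexPoints Y) := by
  haveI : T2Space (Motives.ComplexPoints X) := ComplexPoints.t2Space_of_isSeparated X
  exact T2Space.isSeparatedMap _

section Lifts

variable {A : Type*} [TopologicalSpace A] {s : Set A}
  {g g₁ g₂ : A → Motives.ComplexPoints X}

/-- **Unique lifting through an étale morphism, connected domain**: for `f` étale and `X` separated over `ℂ`, two
continuous maps `g₁ g₂ : A → X(ℂ)` from a preconnected space with `f(ℂ) ∘ g₁ = f(ℂ) ∘ g₂` which agree at one point are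
equal ([Hatcher2002] Prop. 1.34, here for the local homeomorphism `f(ℂ)` of ★ SGA 1 XII 3.1).
[cite: Hatcher2002, §1.3 Prop. 1.34 (p. 62)] [cite: SGA1, Exp. XII Prop. 3.1 (iii)] -/
theorem eq_of_comp_map_eq_of_etale [IsSeparated X.hom] [Etale f.left] [PreconnectedSpace A]
    (h₁ : Continuous g₁) (h₂ : Continuous g₂)
    (he : (map f : Motives.ComplexPoints X → Motives.ComplexPoints Y) ∘ g₁ = map f ∘ g₂) (a : A)
    (ha : g₁ a = g₂ a) : g₁ = g₂ :=
  (isSeparatedMap_map f).eq_of_comp_eq (isLocallyInjective_map_of_etale f) h₁ h₂ he a ha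

/-- **Unique lifting through an étale morphism, on a preconnected set**: `g₁ = g₂` on `s` as soon as they are continuous
on `s`, lift the same map through `f(ℂ)` on `s`, and agree at one point of `s`. [cite: Hatcher2002, §1.3 Prop. 1.34 (p. 62)]
[cite: SGA1, Exp. XII Prop. 3.1 (iii)] -/
theorem eqOn_of_comp_map_eqOn_of_etale [IsSeparated X.hom] [Etale f.left] (hs : IsPreconnected s)
    (h₁ : ContinuousOn g₁ s) (h₂ : ContinuousOn g₂ s)
    (he : s.EqOn ((map f : Motives.ComplexPoints X → Motives.ComplexPoints Y) ∘ g₁) (map f ∘ g₂))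
    {a : A} (has : a ∈ s) (ha : g₁ a = g₂ a) : s.EqOn g₁ g₂ :=
  (isSeparatedMap_map f).eqOn_of_comp_eqOn (isLocallyInjective_map_of_etale f) hs h₁ h₂ he has ha

/-- **Continuous families of points in the fibres of an étale morphism are constant on connected spaces**: for `f` étale,
`X` separated over `ℂ` and `g : A → X(ℂ)` continuous from a preconnected space with `f(ℂ) (g a) = f(ℂ) (g a')` for all
`a, a'`, the map `g` is constant (e.g. a continuously varying `N`-torsion point of a fixed fibre).
[cite: Hatcher2002, §1.3 Prop. 1.34 (p. 62)] [cite: SGA1, Exp. XII Prop. 3.1 (iii)] -/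
theorem const_of_comp_map_const_of_etale [IsSeparated X.hom] [Etale f.left] [PreconnectedSpace A]
    (hg : Continuous g)
    (he : ∀ a a', (map f : Motives.ComplexPoints X → Motives.ComplexPoints Y) (g a) = map f (g a')) (a a' : A) :
    g a = g a' :=
  (isSeparatedMap_map f).const_of_comp (isLocallyInjective_map_of_etale f) hg he a a'

/-- **… and on preconnected sets**: `g` continuous on a preconnected `s` with `f(ℂ) ∘ g` constant on `s` is constant on
`s`. [cite: Hatcher2002, §1.3 Prop. 1.34 (p. 62)] [cite: SGA1, Exp. XII Prop. 3.1 (iii)] -/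
theorem constOn_of_comp_map_const_of_etale [IsSeparated X.hom] [Etale f.left] (hs : IsPreconnected s)
    (hg : ContinuousOn g s)
    (he : ∀ a ∈ s, ∀ a' ∈ s, (map f : Motives.ComplexPoints X → Motives.ComplexPoints Y) (g a) = map f (g a'))
    {a a' : A} (ha : a ∈ s) (ha' : a' ∈ s) : g a = g a' :=
  (isSeparatedMap_map f).constOn_of_comp (isLocallyInjective_map_of_etale f) hs hg he ha ha'

end Lifts

/-! ### Sections over a subset of the base -/

/-- **Two continuous sections of an étale `f(ℂ)` over a preconnected subset of `Y(ℂ)` that agree at one point agree on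
the whole subset** (the case `A = Y(ℂ)`, `g₁, g₂` sections on `s`: `f(ℂ) (gᵢ y) = y` for `y ∈ s`).
[cite: Hatcher2002, §1.3 Prop. 1.34 (p. 62)] [cite: SGA1, Exp. I Cor. 5.3] -/
theorem section_eqOn_of_etale [IsSeparated X.hom] [Etale f.left] {s : Set (Motives.ComplexPoints Y)}
    (hs : IsPreconnected s) {σ₁ σ₂ : Motives.ComplexPoints Y → Motives.ComplexPoints X}
    (h₁ : ContinuousOn σ₁ s) (h₂ : ContinuousOn σ₂ s)
    (hσ₁ : ∀ y ∈ s, (map f : Motives.ComplexPoints X → Motives.ComplexPoints Y) (σ₁ y) = y)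
    (hσ₂ : ∀ y ∈ s, (map f : Motives.ComplexPoints X → Motives.ComplexPoints Y) (σ₂ y) = y)
    {y : Motives.ComplexPoints Y} (hy : y ∈ s) (hyσ : σ₁ y = σ₂ y) : s.EqOn σ₁ σ₂ :=
  eqOn_of_comp_map_eqOn_of_etale f hs h₁ h₂ (fun z hz => by
    change map f (σ₁ z) = map f (σ₂ z); rw [hσ₁ z hz, hσ₂ z hz]) hy hyσ

/-! ### §3 (ed. 2) The same for `f` UNRAMIFIED: formally unramified and locally of finite type, target separated -/

section Unramified

variable {A : Type*} [TopologicalSpace A] {s : Set A}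
  {g g₁ g₂ : A → Motives.ComplexPoints X}

/-- **Unique lifting through an UNRAMIFIED morphism, connected domain**: for `f` formally unramified and locally of finite
type with `X` and `Y` separated over `ℂ`, two continuous maps `g₁ g₂ : A → X(ℂ)` from a preconnected space with
`f(ℂ) ∘ g₁ = f(ℂ) ∘ g₂` which agree at one point are equal (`f(ℂ)` is locally injective, ★ SGA 1 XII 3.1 (ii)
`isLocallyInjective_map_of_formallyUnramified`, and separated). [cite: Hatcher2002, §1.3 Prop. 1.34 (p. 62)]
[cite: SGA1, Exp. XII Prop. 3.1 (ii)] -/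
theorem eq_of_comp_map_eq_of_unramified [IsSeparated X.hom] [IsSeparated Y.hom] [FormallyUnramified f.left]
    [LocallyOfFiniteType f.left] [PreconnectedSpace A] (h₁ : Continuous g₁) (h₂ : Continuous g₂)
    (he : (map f : Motives.ComplexPoints X → Motives.ComplexPoints Y) ∘ g₁ = map f ∘ g₂) (a : A)
    (ha : g₁ a = g₂ a) : g₁ = g₂ :=
  (isSeparatedMap_map f).eq_of_comp_eq (isLocallyInjective_map_of_formallyUnramified (X := Y) f) h₁ h₂ he a ha

/-- **Unique lifting through an unramified morphism, on a preconnected set.** [cite: Hatcher2002, §1.3 Prop. 1.34 (p. 62)]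
[cite: SGA1, Exp. XII Prop. 3.1 (ii)] -/
theorem eqOn_of_comp_map_eqOn_of_unramified [IsSeparated X.hom] [IsSeparated Y.hom] [FormallyUnramified f.left]
    [LocallyOfFiniteType f.left] (hs : IsPreconnected s) (h₁ : ContinuousOn g₁ s) (h₂ : ContinuousOn g₂ s)
    (he : s.EqOn ((map f : Motives.ComplexPoints X → Motives.ComplexPoints Y) ∘ g₁) (map f ∘ g₂))
    {a : A} (has : a ∈ s) (ha : g₁ a = g₂ a) : s.EqOn g₁ g₂ :=
  (isSeparatedMap_map f).eqOn_of_comp_eqOn (isLocallyInjective_map_of_formallyUnramified (X := Y) f) hs h₁ h₂ he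
    has ha

/-- **Continuous families of points in the fibres of an UNRAMIFIED morphism are constant on connected spaces** (e.g. a
continuously varying `N`-torsion point of an abelian scheme over a connected base, `[N]` being unramified).
[cite: Hatcher2002, §1.3 Prop. 1.34 (p. 62)] [cite: SGA1, Exp. XII Prop. 3.1 (ii)] -/
theorem const_of_comp_map_const_of_unramified [IsSeparated X.hom] [IsSeparated Y.hom] [FormallyUnramified f.left]
    [LocallyOfFiniteType f.left] [PreconnectedSpace A] (hg : Continuous g)
    (he : ∀ a a', (map f : Motives.ComplexPoints X → Motives.ComplexPoints Y) (g a) = map f (g a')) (a a' : A) :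
    g a = g a' :=
  (isSeparatedMap_map f).const_of_comp (isLocallyInjective_map_of_formallyUnramified (X := Y) f) hg he a a'

/-- **… and on preconnected sets.** [cite: Hatcher2002, §1.3 Prop. 1.34 (p. 62)] [cite: SGA1, Exp. XII Prop. 3.1 (ii)] -/
theorem constOn_of_comp_map_const_of_unramified [IsSeparated X.hom] [IsSeparated Y.hom] [FormallyUnramified f.left]
    [LocallyOfFiniteType f.left] (hs : IsPreconnected s) (hg : ContinuousOn g s)
    (he : ∀ a ∈ s, ∀ a' ∈ s, (map f : Motives.ComplexPoints X → Motives.ComplexPoints Y) (g a) = map f (g a'))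
    {a a' : A} (ha : a ∈ s) (ha' : a' ∈ s) : g a = g a' :=
  (isSeparatedMap_map f).constOn_of_comp (isLocallyInjective_map_of_formallyUnramified (X := Y) f) hs hg he ha ha'

end Unramified

end Literature.AlgebraicGeometry.FundamentalGroup

end
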